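import Summits.BirchSwinnertonDyer.BirchSwinnertonDyer.Theorems.EisensteinPrimesCharLocalTorsionBound
import Literature.NumberTheory.EllipticCurves.KellerYin2024.AnomalousLambdaInvariants
import HarnessLib

/-!
# Corank bookkeeping of the `≥` half of KY Prop. 1.2.5: a SURJECTION
# `H¹_{𝓕_nr^{Sf}}(K_∞, (F/𝒪)(θ)) ↠ ∏_{w∈Sf} ∏_{i<[Γ:Γ_w]} H¹(K_{∞,γ^{-i}w₀}, (F/𝒪)(θ))` with kernel `H¹_{𝓕_nr}`
# gives `Σ_{w∈Sf} λ(𝒫_w(θ)) ≤ corank_{ℤ_p}(H¹_{𝓕_nr^{Sf}}/H¹_{𝓕_nr})`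

Cell `bsd-eis` (home `run/shared/lean/pub/bsd-eis/`), seat `bsd-line-x1-p1-w2` (gen 1; D-0154 width
seat on crux 2 `GoodLatticeBDPValue` = stmt-BirchSwinnertonDyer-19032, line `halves` v16, stub
`stub_imprimCorank` = `KellerYin2024.prop125_residualPair_unrSelmer_corank_ge`). LEAD verdict v3.1
§3 item (vii) "corank bookkeeping SUR ⇒ `Σ charLocalLambda ≤ zpCorank Q`", ROAD-INDEPENDENT: both
derivations of the `≥` half (road (A): Greenberg 2016 Prop. 2.6.3 + Shapiro descent, LEAD g2 files
`…AcTwistDeformation*`, whose step "LocSurj" is the `K_∞`-side surjectivity onto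
`∏_{w∈Sf} ∏_{i<p^{a_w}} H¹(ker κ ⊓ D_w, M)`; road (B): Pollack–Weston 2011 Prop. A.2,
`PollackWeston2011.globalToLocal` onto `∏_v ℋ_v`, `ℋ_v = Fin (numPlacesAbove κ v) → localH1/loc`)
END with the same algebra, which this file records once, with the local inputs already in the tree:

* §1 `zpCorank_quotient_eq_sum_of_surjective` — GENERIC: `Φ : SS ↠ ∏_i Y_i` surjective with
  `ker Φ = S₁ ∩ SS`, each `Y_i` `p`-primary with finite `p`-torsion ⟹
  `zpCorank (SS/S₁) = Σ_i zpCorank Y_i` (`QuotientAddGroup.quotientKerEquivOfSurjective` +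
  `zpCorank_congr` + `zpCorank_pi`); nested form `zpCorank_quotient_eq_sum_sum_of_surjective` for
  `∏_i ∏_{j : J i} Z i j`.
* §2 **`zpCorank_unrSelmer_quotient_eq_sum_of_surjective`** — for `M = (F/𝒪)(θ)` (`θ^{p−1} = 1`), any
  `ℤ_p`-extension `κ`, `Sf` a finite set of places `w ∤ p` finitely decomposed in `K_∞`, and ANY
  surjection `Φ : unrSelmer κ M v̄ ↑Sf ↠ ∏_{w∈Sf} (J w → H¹(ker κ ⊓ D_w, M))`, `#J w = numPlacesAbove κ w`
  (any indexing of the places above `w`, e.g. `Fin [Γ:Γ_w]` or `Fin (p^{a_w})`), with kernel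
  `unrSelmer κ M v̄ ∅`:
  `zpCorank (Sel^{Sf}/Sel^∅) = Σ_{w∈Sf} numPlacesAbove κ w · zpCorank H¹(ker κ ⊓ D_w, M)`
  (finiteness of the local `p`-torsion: `CharLocalTorsionBound.natCard_torsionBy_localH1_charModule_le`);
  **`sum_charLocalLambda_le_zpCorank_unrSelmer_quotient_of_surjective`** — hence
  **`Σ_{w∈Sf} charLocalLambda ∅ κ θ w ≤ zpCorank (Sel^{Sf}/Sel^∅) p`**, by the per-place lower bound
  `CharLocalTameCorank.ite_le_zpCorank_localH1_charModule` (`corank ≥ 𝟙[θ(Frob_w) ≡ Nw]`). This is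
  LITERALLY the conclusion of `prop125_residualPair_unrSelmer_corank_ge` at a residual character,
  granted the surjection (KY Prop. 1.2.5 (eq:Gr to imp); CGLS Prop. 1.2.5 (eq:sur1)–(eq:sur2)).
* §3 **`sum_charLocalLambda_le_zpCorank_unrSelmer_quotient_at_residualPair_of_surjective`** — the
  same UNDER THE BINDERS OF `prop125_residualPair_unrSelmer_corank_ge` that it uses (`K` imaginary
  quadratic, `2 < p`, (Heeg) for `N`, `κ` anticyclotomic, `θ ∈ {θsub, θquot}` of a residual pair
  `IsResidualPairOver`, `Sf` = primes over `N` not above `p`): `θ^{p−1} = 1` by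
  `IsResidualPairOver.pow_sub_one`, finite decomposition at `Sf` by Brink
  (`exists_mem_decomp_apply_ne_one_of_heegner`) — leaving ONLY the surjection `Φ` (with its kernel)
  as hypothesis: the assembly seat composes this with the global-to-local surjectivity.

HONEST FRAMING: tool theorems only (no definition, no named fact, no `sorry`); the SURJECTION is a
HYPOTHESIS here (it is the content of PW Prop. A.2 / Greenberg Prop. 2.6.3 + the local Shapiro
surjectivity, other files); closes nothing by itself (`--supports stmt-BirchSwinnertonDyer-19032`);
BSD / Mazur's main conjecture / IMC is proved for no curve by this file.

References: Keller–Yin arXiv:2402.12781v2 Prop. 1.2.5 and proof (TeX L780–800), Lemma 1.1.1;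
Castella–Grossi–Lee–Skinner, Invent. Math. 227 (2022) Prop. 1.2.5; Greenberg–Vatsal, Invent. Math.
142 (2000) §2 Cor. (2.3), Prop. (2.4); Pollack–Weston, Compositio 147 (2011) App. A Prop. A.2.
-/

-- `Summit.BirchSwinnertonDyer.BirchSwinnertonDyer.…`: summit and sub-problem share a name (D-0017 layout).
set_option linter.dupNamespace false
set_option autoImplicit false

noncomputable section

open scoped Classical AddSubgroup Pointwise

open CategoryTheory Function Filter Polynomial NumberField IsDedekindDomain Field ValuativeRel WeierstrassCurve
open Literature.NumberTheory.EllipticCurves Literature.NumberTheory.EllipticCurves.GreenbergSelmer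
  Literature.NumberTheory.GaloisRepresentations
  Literature.NumberTheory.EllipticCurves.KellerYin2024 Literature.NumberTheory.IwasawaTheory
  IsDedekindDomain.HeightOneSpectrum
  Summit.BirchSwinnertonDyer.Rank1Residual
  Summit.BirchSwinnertonDyer.Rank1Residual.X2.NonPrimitiveQuotientCorank
  Summit.BirchSwinnertonDyer.Rank1Residual.X11b.Coinv
  Summit.BirchSwinnertonDyer.BirchSwinnertonDyer.Theorems.CharLocalTameCorank
  Summit.BirchSwinnertonDyer.BirchSwinnertonDyer.Theorems.CharLocalTorsionBound
  Summit.BirchSwinnertonDyer.BirchSwinnertonDyer.Theorems.UnrSelmerQuotientTorsionFiniteChar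

universe u v w

namespace Summit.BirchSwinnertonDyer.BirchSwinnertonDyer.Theorems.UnrSelmerQuotientCorankGeOfSurjective

/-! ## §1 Generic: a surjection with known kernel computes the corank of the quotient -/

section Generic

variable {p : ℕ} [hp : Fact p.Prime] {G : Type w} [AddCommGroup G]

/-- **`zpCorank (SS/S₁) = Σ_i zpCorank Y_i`** for additive subgroups `S₁, SS` of `G` and a SURJECTIVE
`Φ : SS →+ ∏_i Y_i` (finite index type) whose kernel is `S₁ ∩ SS`, every `Y_i` being `p`-primary
with finite `p`-torsion: `SS/(S₁ ∩ SS) ≅ SS/ker Φ ≅ ∏_i Y_i` and the corank formula is additive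
over finite products (`zpCorank_pi`). The algebra of Greenberg–Vatsal Cor. (2.3) / KY Prop. 1.2.5
("the exact sequence `0 → Sel → Sel^{S₀} → ∏ ℋ_w → 0` gives `λ(𝔛^S) = λ(𝔛) + Σ λ(𝒫_w)`").
[cite: GreenbergVatsal2000, §2 Cor. (2.3) (pp. 20–21)] [cite: KellerYin2024, Prop. 1.2.5 (arXiv:2402.12781v2 TeX L780–800)] -/
theorem zpCorank_quotient_eq_sum_of_surjective (S₁ SS : AddSubgroup G) {ι : Type u} [Fintype ι]
    {Y : ι → Type v} [∀ i, AddCommGroup (Y i)] (Φ : ↥SS →+ (∀ i, Y i)) (hΦ : Surjective Φ)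
    (hker : Φ.ker = S₁.addSubgroupOf SS) (hY : ∀ i (y : Y i), ∃ n : ℕ, p ^ n • y = 0)
    [∀ i, Finite ((Y i)[(p : ℤ)])] :
    zpCorank (↥SS ⧸ S₁.addSubgroupOf SS) p = ∑ i, zpCorank (Y i) p := by
  have e : (↥SS ⧸ S₁.addSubgroupOf SS) ≃+ (∀ i, Y i) :=
    (QuotientAddGroup.quotientAddEquivOfEq hker.symm).trans
      (QuotientAddGroup.quotientKerEquivOfSurjective Φ hΦ)
  rw [zpCorank_congr e p]
  exact zpCorank_pi hY

/-- **Nested form: `zpCorank (SS/S₁) = Σ_i Σ_{j : J i} zpCorank (Z i j)`** for a surjection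
`Φ : SS ↠ ∏_i ∏_{j : J i} Z i j` with kernel `S₁ ∩ SS` (all `Z i j` `p`-primary with finite
`p`-torsion). [cite: GreenbergVatsal2000, §2 Cor. (2.3) (pp. 20–21)] -/
theorem zpCorank_quotient_eq_sum_sum_of_surjective (S₁ SS : AddSubgroup G) {ι : Type u} [Fintype ι]
    {J : ι → Type u} [∀ i, Fintype (J i)] {Z : (i : ι) → J i → Type v}
    [∀ i j, AddCommGroup (Z i j)] (Φ : ↥SS →+ (∀ i, ∀ j : J i, Z i j)) (hΦ : Surjective Φ)
    (hker : Φ.ker = S₁.addSubgroupOf SS) (hZ : ∀ i j (z : Z i j), ∃ n : ℕ, p ^ n • z = 0)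
    [hfin : ∀ i j, Finite ((Z i j)[(p : ℤ)])] :
    zpCorank (↥SS ⧸ S₁.addSubgroupOf SS) p = ∑ i, ∑ j, zpCorank (Z i j) p := by
  haveI : ∀ i, Finite ((∀ j : J i, Z i j)[(p : ℤ)]) := fun i ↦ finite_torsionBy_pi
  rw [zpCorank_quotient_eq_sum_of_surjective S₁ SS Φ hΦ hker (fun i ↦ primary_pi (hZ i))]
  exact Finset.sum_congr rfl fun i _ ↦ zpCorank_pi (hZ i)

end Generic

/-! ## §2 Keller–Yin's `H¹_{𝓕_nr^{Sf}}/H¹_{𝓕_nr}` for `(F/𝒪)(θ)` -/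

section Character

variable {K : Type} [Field K] [NumberField K] {p : ℕ} [hp : Fact p.Prime]
  (θ : FramedGaloisRep K (padicCoeffIntegers (∅ : Set (PadicAlgCl p))) 1) (κ : ZpExtension K p)
  (vbar : HeightOneSpectrum (𝓞 K)) (Sf : Finset (HeightOneSpectrum (𝓞 K)))

/-- `H¹(ker κ ⊓ D_w, M)` is `p`-primary for a `p`-primary discrete `M` (compactness of the closed
subgroup `ker κ ⊓ D_w`; a continuous cocycle takes finitely many values). [cite: GreenbergLNM1716, §1 (after Conj. 1.3)] -/
theorem exists_pow_smul_localH1_eq_zero {M : Type} [AddCommGroup M]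
    [DistribMulAction (absoluteGaloisGroup K) M] [TopologicalSpace M] [DiscreteTopology M]
    (htor : ∀ m : M, ∃ k : ℕ, p ^ k • m = 0) (w : HeightOneSpectrum (𝓞 K))
    (x : Literature.NumberTheory.EllipticCurves.subgroupH1 (κ.kerSubgroup ⊓ decomp w) M) :
    ∃ k : ℕ, p ^ k • x = 0 := by
  haveI : CompactSpace (absoluteGaloisGroup K) := absoluteGaloisGroup_compactSpace K
  have hcl : IsClosed ((κ.kerSubgroup ⊓ decomp w : Subgroup (absoluteGaloisGroup K)) :
      Set (absoluteGaloisGroup K)) := by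
    rw [Subgroup.coe_inf]
    exact κ.isClosed_kerSubgroup.inter (isClosed_decomp w)
  haveI : CompactSpace (κ.kerSubgroup ⊓ decomp w : Subgroup (absoluteGaloisGroup K)) :=
    isCompact_iff_compactSpace.mp hcl.isCompact
  obtain ⟨c, rfl⟩ := oneCocycleClass_surjective _ x
  exact IwasawaDual.exists_pow_smul_oneCocycleClass_eq_zero c fun g ↦ htor (c.1 g)

/-- **`zpCorank (H¹_{𝓕_nr^{Sf}}/H¹_{𝓕_nr}) = Σ_{w∈Sf} [Γ:Γ_w] · corank_{ℤ_p} H¹(ker κ ⊓ D_w, (F/𝒪)(θ))`**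
granted a SURJECTION `Φ : H¹_{𝓕_nr^{Sf}}(K_∞, (F/𝒪)(θ)) ↠ ∏_{w∈Sf} ∏_{i<[Γ:Γ_w]} H¹(ker κ ⊓ D_w, (F/𝒪)(θ))`
with kernel `H¹_{𝓕_nr}` (e.g. `c ↦ (res_{ker κ ⊓ D_w}(conj_{γ^i} c))_{w,i}`, onto by the
surjectivity of the global-to-local map — PW Prop. A.2 / Greenberg Prop. 2.6.3 with the local
Shapiro surjectivity — and with kernel `H¹_{𝓕_nr}` because unramified = locally trivial at these
`w`): for `θ^{p−1} = 1`, `Sf` a finite set of places `w ∤ p` finitely decomposed in the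
`ℤ_p`-extension `κ`. Each factor is `p`-primary with FINITE `p`-torsion
(`CharLocalTorsionBound.natCard_torsionBy_localH1_charModule_le`), so `zpCorank` is additive.
[cite: KellerYin2024, Prop. 1.2.5 and proof (eq:Gr to imp) (arXiv:2402.12781v2 TeX L780–800)]
[cite: GreenbergVatsal2000, §2 Cor. (2.3), Prop. (2.4)] [cite: PollackWeston2011, App. A Prop. A.2] -/
theorem zpCorank_unrSelmer_quotient_eq_sum_of_surjective
    (hθ : ∀ σ : absoluteGaloisGroup K, θ σ ^ (p - 1) = 1)
    (hSfp : ∀ w ∈ Sf, ((p : ℕ) : 𝓞 K) ∉ w.asIdeal)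
    (hSfdec : ∀ w ∈ Sf, ¬ (decomp w ≤ κ.kerSubgroup))
    {J : ↥Sf → Type} [∀ w, Fintype (J w)]
    (hJ : ∀ w : ↥Sf, Fintype.card (J w) = numPlacesAbove κ (w : HeightOneSpectrum (𝓞 K)))
    (Φ : ↥(unrSelmer κ (charModule (∅ : Set (PadicAlgCl p)) θ) vbar
        (↑Sf : Set (HeightOneSpectrum (𝓞 K)))) →+
      (∀ w : ↥Sf, J w →
        Literature.NumberTheory.EllipticCurves.subgroupH1
          (κ.kerSubgroup ⊓ decomp (w : HeightOneSpectrum (𝓞 K))) (charModule (∅ : Set (PadicAlgCl p)) θ)))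
    (hΦ : Surjective Φ)
    (hker : Φ.ker = (unrSelmer κ (charModule (∅ : Set (PadicAlgCl p)) θ) vbar
      (∅ : Set (HeightOneSpectrum (𝓞 K)))).addSubgroupOf
        (unrSelmer κ (charModule (∅ : Set (PadicAlgCl p)) θ) vbar (↑Sf : Set (HeightOneSpectrum (𝓞 K))))) :
    zpCorank (↥(unrSelmer κ (charModule (∅ : Set (PadicAlgCl p)) θ) vbar
        (↑Sf : Set (HeightOneSpectrum (𝓞 K)))) ⧸
      (unrSelmer κ (charModule (∅ : Set (PadicAlgCl p)) θ) vbar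
        (∅ : Set (HeightOneSpectrum (𝓞 K)))).addSubgroupOf
          (unrSelmer κ (charModule (∅ : Set (PadicAlgCl p)) θ) vbar
            (↑Sf : Set (HeightOneSpectrum (𝓞 K))))) p =
      ∑ w ∈ Sf, numPlacesAbove κ w *
        zpCorank (Literature.NumberTheory.EllipticCurves.subgroupH1 (κ.kerSubgroup ⊓ decomp w)
          (charModule (∅ : Set (PadicAlgCl p)) θ)) p := by
  have htor : ∀ m : charModule (∅ : Set (PadicAlgCl p)) θ, ∃ k : ℕ, p ^ k • m = 0 :=
    GreenbergSelmer.exists_pow_smul_cofree_eq_zero (∅ : Set (PadicAlgCl p)) θ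
  have hfin : ∀ (w : ↥Sf) (_ : J w),
      Finite ((Literature.NumberTheory.EllipticCurves.subgroupH1
        (κ.kerSubgroup ⊓ decomp (w : HeightOneSpectrum (𝓞 K)))
          (charModule (∅ : Set (PadicAlgCl p)) θ))[(p : ℤ)]) := fun w _ ↦
    (natCard_torsionBy_localH1_charModule_le θ κ hθ (hSfp w w.2) (hSfdec w w.2)).1
  rw [zpCorank_quotient_eq_sum_sum_of_surjective (hfin := hfin) _ _ Φ hΦ hker
    (fun w _ x ↦ exists_pow_smul_localH1_eq_zero κ htor (w : HeightOneSpectrum (𝓞 K)) x)]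
  rw [← Finset.sum_coe_sort Sf]
  refine Finset.sum_congr rfl fun w _ ↦ ?_
  rw [Finset.sum_const, Finset.card_univ, hJ w, smul_eq_mul]

/-- **`Σ_{w∈Sf} charLocalLambda ∅ κ θ w ≤ zpCorank (H¹_{𝓕_nr^{Sf}}/H¹_{𝓕_nr}) p`** — the CONCLUSION of
`KellerYin2024.prop125_residualPair_unrSelmer_corank_ge` for the character `θ` (`θ^{p−1} = 1`),
granted a surjection `Φ : H¹_{𝓕_nr^{Sf}}(K_∞, (F/𝒪)(θ)) ↠ ∏_{w∈Sf} ∏_{i<[Γ:Γ_w]} H¹(ker κ ⊓ D_w, (F/𝒪)(θ))`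
with kernel `H¹_{𝓕_nr}` (`Sf` = places `w ∤ p` finitely decomposed in `K_∞`, e.g. the primes over
`N_E` under (Heeg), `exists_mem_decomp_apply_ne_one_of_heegner`). Corank bookkeeping
(`zpCorank_unrSelmer_quotient_eq_sum_of_surjective`) + the per-place LOWER bound of KY Lemma 1.1.1
(`CharLocalTameCorank.charLocalLambda_le_numPlacesAbove_mul_zpCorank_localH1`:
`charLocalLambda = [Γ:Γ_w]·𝟙[θ(Frob_w) ≡ Nw] ≤ [Γ:Γ_w]·corank H¹(ker κ ⊓ D_w, (F/𝒪)(θ))`).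
[cite: KellerYin2024, Prop. 1.2.5 and proof (arXiv:2402.12781v2 TeX L780–800), Lemma 1.1.1 (L455–462)]
[cite: CastellaGrossiLeeSkinner2022, Prop. 1.2.5 (eq:sur1)–(eq:sur2), Lemma 1.1.1]
[cite: PollackWeston2011, App. A Prop. A.2] [cite: GreenbergVatsal2000, §2 Cor. (2.3), Prop. (2.4)] -/
theorem sum_charLocalLambda_le_zpCorank_unrSelmer_quotient_of_surjective
    (hθ : ∀ σ : absoluteGaloisGroup K, θ σ ^ (p - 1) = 1)
    (hSfp : ∀ w ∈ Sf, ((p : ℕ) : 𝓞 K) ∉ w.asIdeal)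
    (hSfdec : ∀ w ∈ Sf, ¬ (decomp w ≤ κ.kerSubgroup))
    {J : ↥Sf → Type} [∀ w, Fintype (J w)]
    (hJ : ∀ w : ↥Sf, Fintype.card (J w) = numPlacesAbove κ (w : HeightOneSpectrum (𝓞 K)))
    (Φ : ↥(unrSelmer κ (charModule (∅ : Set (PadicAlgCl p)) θ) vbar
        (↑Sf : Set (HeightOneSpectrum (𝓞 K)))) →+
      (∀ w : ↥Sf, J w →
        Literature.NumberTheory.EllipticCurves.subgroupH1
          (κ.kerSubgroup ⊓ decomp (w : HeightOneSpectrum (𝓞 K))) (charModule (∅ : Set (PadicAlgCl p)) θ)))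
    (hΦ : Surjective Φ)
    (hker : Φ.ker = (unrSelmer κ (charModule (∅ : Set (PadicAlgCl p)) θ) vbar
      (∅ : Set (HeightOneSpectrum (𝓞 K)))).addSubgroupOf
        (unrSelmer κ (charModule (∅ : Set (PadicAlgCl p)) θ) vbar (↑Sf : Set (HeightOneSpectrum (𝓞 K))))) :
    ∑ w ∈ Sf, charLocalLambda (∅ : Set (PadicAlgCl p)) κ θ w ≤
      zpCorank (↥(unrSelmer κ (charModule (∅ : Set (PadicAlgCl p)) θ) vbar
          (↑Sf : Set (HeightOneSpectrum (𝓞 K)))) ⧸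
        (unrSelmer κ (charModule (∅ : Set (PadicAlgCl p)) θ) vbar
          (∅ : Set (HeightOneSpectrum (𝓞 K)))).addSubgroupOf
            (unrSelmer κ (charModule (∅ : Set (PadicAlgCl p)) θ) vbar
              (↑Sf : Set (HeightOneSpectrum (𝓞 K))))) p := by
  rw [zpCorank_unrSelmer_quotient_eq_sum_of_surjective θ κ vbar Sf hθ hSfp hSfdec hJ Φ hΦ hker]
  exact Finset.sum_le_sum fun w hw ↦
    charLocalLambda_le_numPlacesAbove_mul_zpCorank_localH1 θ κ hθ (hSfp w hw) (hSfdec w hw)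

/-! ## §3 Under the binders of `prop125_residualPair_unrSelmer_corank_ge` -/

/-- **`Σ_{w∈Sf} charLocalLambda ∅ κ θ w ≤ zpCorank (H¹_{𝓕_nr^{Sf}}/H¹_{𝓕_nr}) p` AT A RESIDUAL PAIR, granted
the surjection** — for `K` imaginary quadratic, `2 < p`, (Heeg) for `N`, `κ` anticyclotomic, any
`vbar`, `θ ∈ {θsub, θquot}` with `IsResidualPairOver WK p θsub θquot` (so `θ^{p−1} = 1`), `Sf` the
primes over `N` not above `p` (finitely decomposed in `K_∞^{ac}` by Brink 2007), and ANY surjection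
`Φ : H¹_{𝓕_nr^{Sf}}(K_∞, (F/𝒪)(θ)) ↠ ∏_{w∈Sf} (J w → H¹(ker κ ⊓ D_w, (F/𝒪)(θ)))`, `#J w = [Γ:Γ_w]`, with
kernel `H¹_{𝓕_nr}`. This is the conclusion of `KellerYin2024.prop125_residualPair_unrSelmer_corank_ge`
with every hypothesis it states discharged except the SURJECTIVITY of the global-to-local map
(Pollack–Weston Prop. A.2 / Greenberg Prop. 2.6.3 + [RH], the assembly seat's input).
[cite: KellerYin2024, Prop. 1.2.5 and proof (arXiv:2402.12781v2 TeX L780–800), Lemma 1.1.1 (L455–462), §1.4 (L1066–1081)]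
[cite: CastellaGrossiLeeSkinner2022, Prop. 1.2.5 (eq:sur1)–(eq:sur2)] [cite: Brink2007, Thm. 2] -/
theorem sum_charLocalLambda_le_zpCorank_unrSelmer_quotient_at_residualPair_of_surjective
    (hK : IsImaginaryQuadratic K) (hp2 : 2 < p) {N : ℕ} (hH : SatisfiesHeegnerHypothesis N K)
    {WK : WeierstrassCurve K} (hκ : κ.IsAnticyclotomic)
    (θsub θquot : FramedGaloisRep K (padicCoeffIntegers (∅ : Set (PadicAlgCl p))) 1)
    (hpair : IsResidualPairOver WK p θsub θquot)
    (hSf : ∀ w : HeightOneSpectrum (𝓞 K), w ∈ Sf ↔ ((N : ℤ) : 𝓞 K) ∈ w.asIdeal)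
    (hSp : ∀ w ∈ Sf, ((p : ℕ) : 𝓞 K) ∉ w.asIdeal)
    (hθ : θ = θsub ∨ θ = θquot)
    {J : ↥Sf → Type} [∀ w, Fintype (J w)]
    (hJ : ∀ w : ↥Sf, Fintype.card (J w) = numPlacesAbove κ (w : HeightOneSpectrum (𝓞 K)))
    (Φ : ↥(unrSelmer κ (charModule (∅ : Set (PadicAlgCl p)) θ) vbar
        (↑Sf : Set (HeightOneSpectrum (𝓞 K)))) →+
      (∀ w : ↥Sf, J w →
        Literature.NumberTheory.EllipticCurves.subgroupH1
          (κ.kerSubgroup ⊓ decomp (w : HeightOneSpectrum (𝓞 K))) (charModule (∅ : Set (PadicAlgCl p)) θ)))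
    (hΦ : Surjective Φ)
    (hker : Φ.ker = (unrSelmer κ (charModule (∅ : Set (PadicAlgCl p)) θ) vbar
      (∅ : Set (HeightOneSpectrum (𝓞 K)))).addSubgroupOf
        (unrSelmer κ (charModule (∅ : Set (PadicAlgCl p)) θ) vbar (↑Sf : Set (HeightOneSpectrum (𝓞 K))))) :
    ∑ w ∈ Sf, charLocalLambda (∅ : Set (PadicAlgCl p)) κ θ w ≤
      zpCorank (↥(unrSelmer κ (charModule (∅ : Set (PadicAlgCl p)) θ) vbar
          (↑Sf : Set (HeightOneSpectrum (𝓞 K)))) ⧸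
        (unrSelmer κ (charModule (∅ : Set (PadicAlgCl p)) θ) vbar
          (∅ : Set (HeightOneSpectrum (𝓞 K)))).addSubgroupOf
            (unrSelmer κ (charModule (∅ : Set (PadicAlgCl p)) θ) vbar
              (↑Sf : Set (HeightOneSpectrum (𝓞 K))))) p := by
  have hθ' : ∀ σ : absoluteGaloisGroup K, θ σ ^ (p - 1) = 1 := fun σ ↦ by
    rcases hθ with rfl | rfl
    · exact (hpair.pow_sub_one σ).1
    · exact (hpair.pow_sub_one σ).2
  have hdec : ∀ w ∈ Sf, ¬ (decomp w ≤ κ.kerSubgroup) := fun w hw hle ↦ by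
    obtain ⟨δ, hδ, hne⟩ := exists_mem_decomp_apply_ne_one_of_heegner hK hp2 hH κ hκ w
      ((hSf w).mp hw) (hSp w hw)
    exact hne (ZpExtension.mem_kerSubgroup.mp (hle hδ))
  exact sum_charLocalLambda_le_zpCorank_unrSelmer_quotient_of_surjective θ κ vbar Sf hθ' hSp hdec
    hJ Φ hΦ hker

end Character

end Summit.BirchSwinnertonDyer.BirchSwinnertonDyer.Theorems.UnrSelmerQuotientCorankGeOfSurjective

end
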